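import Literature.NumberTheory.Automorphic.UnitaryLatticeTreeFixedCosetStrataDictionary   -- ★ `mapGL_stdLattice_eq_iff_mem_glInt`, `mapGL_mapGL_stdLattice_eq_iff_mem_glInt`; brings `mem_fixedBy_quotient_mk_iff`, the `Valued` ↔ `ValuativeRel` bridge, ★ T1a `UnitaryLatticeTreeDefs` (`mapGL`, `latticeGraphIso`, `IsVertexLattice`)
import HarnessLib

/-!
# FIXED COSETS OF THE VERTEX ∕ EDGE STABILISERS `K₀`, `K₁ = Stab(g₁·L₀)`, `K₀ ⊓ K₁` ↔ FIXED VERTICES AND FLAGS OF THE LATTICE GRAPH (any rank `N`, any form `H`)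
# (Kottwitz 1986 §3, 1988 §2; Serre, *Trees*, II.1.1; Bruhat–Tits 1972 §10) — the rank-`N` twin of the dictionary of ★ `HermitianLatticeTreeEulerRelation`

Topic `NumberTheory/Automorphic`; namespace `Literature.NumberTheory.Automorphic.UnitaryLatticeTree`.  THEOREMS ONLY (no definition ∕ instance ∕ notation ∕ named fact ∕ `sorry`).
Cell `pub/hodgecm-mathlib`, crux H413 = `stmt-HodgeConjecture-24833` (`--supports` lane, helper), LH6 rung-0 residue, CENSUS «EP-G» v1 (F0P3a-p09 (g12)) §5 brick (G2) «(E)-G», FILE 1 of 2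
(FILE 2 = ★-to-be `UnitaryLatticeTreeEulerRelation`: the Euler–Poincaré relation on the `U(3)` tree).  Seat LH6-p03 (g8).  HONEST LABEL: count-neutral (elementary coset ∕ lattice bookkeeping;
nothing printed is asserted); HC_CM is proved only modulo the 7 printed citations (2 remaining named inputs hLiu418 = stmt-HodgeConjecture-24832, h413 = stmt-HodgeConjecture-24833) until
rung 0 closes.

THE OBJECTS.  `K` a field with `Valued K ℤᵐ⁰` and the compatible `ValuativeRel` (for ★ `glInt N K = GL_N(𝒪)`), `σ : K →+* K`, `H ∈ M_N(K)`, `U := unitaryGroupOfForm σ H ≤ GL_N(K)` acting on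
lattices by ★ `mapGL` and on the ★ `latticeGraph σ ϖ H` by ★ `latticeGraphIso`; `L₀ = 𝒪^N = stdLattice K N` the root, `g₁ ∈ GL_N(K)` any element (the consumer takes `g₁ = diag(1,1,ϖ)`,
`g₁·L₀ = N₁`); `K₀ := (glInt N K).subgroupOf U = Stab_U(L₀)`, `K₁ := ((glInt N K).map (conj g₁)).subgroupOf U = Stab_U(g₁·L₀)`, `K₀ ⊓ K₁` the stabiliser of the flag `(L₀, g₁·L₀)`.
* §1 DICTIONARY (`γ, u ∈ U`): `u K₀ ∈ Fix_γ(U ⧸ K₀) ↔ γ·(u·L₀) = u·L₀`, `u K₁ ∈ Fix_γ(U ⧸ K₁) ↔ γ·((u g₁)·L₀) = (u g₁)·L₀`, the `K₀ ⊓ K₁` conjunction, and the corresponding coset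
  equalities — `mapGL_conj_stdLattice_eq_iff`, `mapGL_inv_mul_stdLattice_eq_iff`, `mk_mem_fixedBy_iff_mapGL_stdLattice_eq`, `mk_mem_fixedBy_conj_iff_mapGL_stdLattice_eq`,
  `mk_eq_mk_iff_mapGL_stdLattice_eq`, `mk_eq_mk_conj_iff_mapGL_stdLattice_eq`, `mk_mem_fixedBy_inf_iff_rankN`, `mk_eq_mk_inf_iff_rankN`, `latticeGraphIso_apply_eq_self_iff`.
* §2 THE THREE EQUIVALENCES WITH VALUES (`e (uC) = u·L₀` ∕ `(u g₁)·L₀` ∕ the flag — hence `Z_U(γ)`-equivariant), transitivity as binders: (A) `exists_fixedBy_equiv_fixed_selfDual_rankN` — `Fix_γ(U ⧸ K₀) ≃` the `γ`-fixed self-dual vertices (root self-dual, `U`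
  transitive on self-dual lattices); (B) `exists_fixedBy_conj_equiv_fixed_type` — `Fix_γ(U ⧸ K₁) ≃` the `γ`-fixed vertices of type `d` (`g₁·L₀` of type `d`, `U` transitive on
  type-`d` lattices); (I) `exists_fixed_flag_of_mem_fixedBy_inf_rankN`, `exists_fixedBy_inf_equiv_fixed_flags_rankN` — `Fix_γ(U ⧸ (K₀ ⊓ K₁)) ≃` the `γ`-fixed flags `(L, M)`,
  `L` self-dual, `M` of type `d`, `M < L` (`g₁·L₀ < L₀`, `U` transitive on such flags).
The proofs are the rank-2 ones of ★ `HermitianLatticeTree.nonempty_fixedBy_equiv_fixed_selfDual` ∕ `…_modular` ∕ `…_inf_equiv_fixed_flags` token for token, in the rank-`N` currency of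
★ `UnitaryLatticeTreeDefs` (`mapGL u (stdLattice K N) = latt u` by `rfl`) over ★ `mapGL_stdLattice_eq_iff_mem_glInt` ∕ ★ `mapGL_mapGL_stdLattice_eq_iff_mem_glInt`.

## References
* [Kottwitz1986] R. E. Kottwitz, *Base change for unit elements of Hecke algebras*, Compositio Math. 60 (1986), §3 (fixed cosets = stable lattices).
* [Kottwitz1988] R. E. Kottwitz, *Tamagawa numbers*, Ann. of Math. 127 (1988), §2 (Euler–Poincaré functions and fixed facets of the building).
* [Serre1980Trees] J.-P. Serre, *Trees* (1980), II.1.1 (lattice trees: vertices, edges, stabilisers).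
* [BruhatTits1972] F. Bruhat, J. Tits, *Groupes réductifs sur un corps local I*, Publ. IHÉS 41 (1972), §10 (unitary groups: vertices of the building as lattices).
-/

set_option autoImplicit false

noncomputable section

open Matrix Literature.NumberTheory.Automorphic Literature.Combinatorics.SimpleGraph
open Literature.NumberTheory.Automorphic.HermitianLattice Literature.NumberTheory.Automorphic.UnitaryGroup Literature.NumberTheory.Automorphic.CartanUnique
open scoped Matrix MatrixGroups WithZero Valued

namespace Literature.NumberTheory.Automorphic.UnitaryLatticeTree

variable {K : Type*} [Field K] [Valued K ℤᵐ⁰] [ValuativeRel K] [(Valued.v : Valuation K ℤᵐ⁰).Compatible] {N : ℕ}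


/-! ## §1 The dictionary: fixed cosets of `K₀`, `K₁ = Stab(g₁·L₀)`, `K₀ ⊓ K₁` ↔ fixed lattices (any rank, any form) -/

section Dictionary

variable (σ : K →+* K) (ϖ : K) (H : Matrix (Fin N) (Fin N) K)

omit [ValuativeRel K] [(Valued.v : Valuation K ℤᵐ⁰).Compatible] in
/-- `g⁻¹γg` fixes the root `L₀ = 𝒪^N` iff `γ` fixes `g·L₀`. [cite: Serre1980Trees, II.1.1] [cite: Kottwitz1986, §3] -/
theorem mapGL_conj_stdLattice_eq_iff (γ g : GL (Fin N) K) :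
    mapGL (g⁻¹ * γ * g) (stdLattice K N) = stdLattice K N ↔ mapGL γ (mapGL g (stdLattice K N)) = mapGL g (stdLattice K N) := by
  rw [← (mapGL_injective g).eq_iff, ← mapGL_mul, show g * (g⁻¹ * γ * g) = γ * g by group, mapGL_mul]

omit [ValuativeRel K] [(Valued.v : Valuation K ℤᵐ⁰).Compatible] in
/-- `g⁻¹g′` fixes the root iff `g·L₀ = g′·L₀`. [cite: Serre1980Trees, II.1.1] -/
theorem mapGL_inv_mul_stdLattice_eq_iff (g g' : GL (Fin N) K) :
    mapGL (g⁻¹ * g') (stdLattice K N) = stdLattice K N ↔ mapGL g (stdLattice K N) = mapGL g' (stdLattice K N) := by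
  rw [← (mapGL_injective g).eq_iff, ← mapGL_mul, ← mul_assoc, mul_inv_cancel, one_mul, eq_comm]

/-- **Dictionary (K₀)**: `u K₀ ∈ Fix_γ(U ⧸ K₀)` iff `γ` fixes the lattice `u·L₀` (`K₀ = U ∩ GL_N(𝒪) = Stab_U(L₀)`). [cite: Kottwitz1986, §3] [cite: Serre1980Trees, II.1.1] -/
theorem mk_mem_fixedBy_iff_mapGL_stdLattice_eq (γ u : ↥(unitaryGroupOfForm σ H)) :
    ((u : ↥(unitaryGroupOfForm σ H) ⧸ (glInt N K).subgroupOf (unitaryGroupOfForm σ H)) ∈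
        MulAction.fixedBy (↥(unitaryGroupOfForm σ H) ⧸ (glInt N K).subgroupOf (unitaryGroupOfForm σ H)) γ) ↔
      mapGL (γ : GL (Fin N) K) (mapGL (u : GL (Fin N) K) (stdLattice K N)) = mapGL (u : GL (Fin N) K) (stdLattice K N) := by
  rw [mem_fixedBy_quotient_mk_iff, Subgroup.mem_subgroupOf, mapGL_mapGL_stdLattice_eq_iff_mem_glInt]

/-- **Dictionary (K₁)**: `u K₁ ∈ Fix_γ(U ⧸ K₁)` iff `γ` fixes the lattice `(u g₁)·L₀` (`K₁ = U ∩ g₁ GL_N(𝒪) g₁⁻¹ = Stab_U(g₁·L₀)`). [cite: Kottwitz1986, §3] [cite: Serre1980Trees, II.1.1] -/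
theorem mk_mem_fixedBy_conj_iff_mapGL_stdLattice_eq (g₁ : GL (Fin N) K) (γ u : ↥(unitaryGroupOfForm σ H)) :
    ((u : ↥(unitaryGroupOfForm σ H) ⧸ ((glInt N K).map (MulAut.conj g₁).toMonoidHom).subgroupOf (unitaryGroupOfForm σ H)) ∈
        MulAction.fixedBy (↥(unitaryGroupOfForm σ H) ⧸ ((glInt N K).map (MulAut.conj g₁).toMonoidHom).subgroupOf (unitaryGroupOfForm σ H)) γ) ↔
      mapGL (γ : GL (Fin N) K) (mapGL ((u : GL (Fin N) K) * g₁) (stdLattice K N)) = mapGL ((u : GL (Fin N) K) * g₁) (stdLattice K N) := by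
  rw [mem_fixedBy_quotient_mk_iff, Subgroup.mem_subgroupOf, Subgroup.coe_mul, Subgroup.coe_mul, Subgroup.coe_inv, Subgroup.mem_map_equiv,
    MulAut.conj_symm_apply, ← mapGL_stdLattice_eq_iff_mem_glInt, ← mapGL_conj_stdLattice_eq_iff γ ((u : GL (Fin N) K) * g₁)]
  have h : g₁⁻¹ * ((u : GL (Fin N) K)⁻¹ * (γ : GL (Fin N) K) * (u : GL (Fin N) K)) * g₁ = ((u : GL (Fin N) K) * g₁)⁻¹ * (γ : GL (Fin N) K) * ((u : GL (Fin N) K) * g₁) := by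
    group
  rw [h]

/-- Cosets of `K₀`: `u K₀ = u′ K₀` iff `u·L₀ = u′·L₀`. [cite: Kottwitz1986, §3] -/
theorem mk_eq_mk_iff_mapGL_stdLattice_eq (u u' : ↥(unitaryGroupOfForm σ H)) :
    ((u : ↥(unitaryGroupOfForm σ H) ⧸ (glInt N K).subgroupOf (unitaryGroupOfForm σ H)) = u') ↔
      mapGL (u : GL (Fin N) K) (stdLattice K N) = mapGL (u' : GL (Fin N) K) (stdLattice K N) := by
  rw [QuotientGroup.eq, Subgroup.mem_subgroupOf, Subgroup.coe_mul, Subgroup.coe_inv, ← mapGL_stdLattice_eq_iff_mem_glInt, mapGL_inv_mul_stdLattice_eq_iff]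

/-- Cosets of `K₁`: `u K₁ = u′ K₁` iff `(u g₁)·L₀ = (u′ g₁)·L₀`. [cite: Kottwitz1986, §3] -/
theorem mk_eq_mk_conj_iff_mapGL_stdLattice_eq (g₁ : GL (Fin N) K) (u u' : ↥(unitaryGroupOfForm σ H)) :
    ((u : ↥(unitaryGroupOfForm σ H) ⧸ ((glInt N K).map (MulAut.conj g₁).toMonoidHom).subgroupOf (unitaryGroupOfForm σ H)) = u') ↔
      mapGL ((u : GL (Fin N) K) * g₁) (stdLattice K N) = mapGL ((u' : GL (Fin N) K) * g₁) (stdLattice K N) := by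
  rw [QuotientGroup.eq, Subgroup.mem_subgroupOf, Subgroup.coe_mul, Subgroup.coe_inv, Subgroup.mem_map_equiv, MulAut.conj_symm_apply,
    ← mapGL_stdLattice_eq_iff_mem_glInt, ← mapGL_inv_mul_stdLattice_eq_iff ((u : GL (Fin N) K) * g₁)]
  have h : g₁⁻¹ * ((u : GL (Fin N) K)⁻¹ * (u' : GL (Fin N) K)) * g₁ = ((u : GL (Fin N) K) * g₁)⁻¹ * ((u' : GL (Fin N) K) * g₁) := by group
  rw [h]

/-- **Dictionary (K₀ ⊓ K₁)**: `u (K₀ ⊓ K₁) ∈ Fix_γ` iff `γ` fixes both lattices `u·L₀` and `(u g₁)·L₀` (the EDGE `u · (L₀, N₁)`). [cite: Kottwitz1988, §2] -/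
theorem mk_mem_fixedBy_inf_iff_rankN (g₁ : GL (Fin N) K) (γ u : ↥(unitaryGroupOfForm σ H)) :
    ((u : ↥(unitaryGroupOfForm σ H) ⧸ ((glInt N K).subgroupOf (unitaryGroupOfForm σ H) ⊓ ((glInt N K).map (MulAut.conj g₁).toMonoidHom).subgroupOf (unitaryGroupOfForm σ H))) ∈
        MulAction.fixedBy (↥(unitaryGroupOfForm σ H) ⧸ ((glInt N K).subgroupOf (unitaryGroupOfForm σ H) ⊓
          ((glInt N K).map (MulAut.conj g₁).toMonoidHom).subgroupOf (unitaryGroupOfForm σ H))) γ) ↔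
      mapGL (γ : GL (Fin N) K) (mapGL (u : GL (Fin N) K) (stdLattice K N)) = mapGL (u : GL (Fin N) K) (stdLattice K N) ∧
        mapGL (γ : GL (Fin N) K) (mapGL ((u : GL (Fin N) K) * g₁) (stdLattice K N)) = mapGL ((u : GL (Fin N) K) * g₁) (stdLattice K N) := by
  rw [mem_fixedBy_quotient_mk_iff, Subgroup.mem_inf, ← mem_fixedBy_quotient_mk_iff, ← mem_fixedBy_quotient_mk_iff, mk_mem_fixedBy_iff_mapGL_stdLattice_eq,
    mk_mem_fixedBy_conj_iff_mapGL_stdLattice_eq]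

/-- Cosets of `K₀ ⊓ K₁`: equal iff both lattices agree. [cite: Kottwitz1988, §2] -/
theorem mk_eq_mk_inf_iff_rankN (g₁ : GL (Fin N) K) (u u' : ↥(unitaryGroupOfForm σ H)) :
    ((u : ↥(unitaryGroupOfForm σ H) ⧸ ((glInt N K).subgroupOf (unitaryGroupOfForm σ H) ⊓ ((glInt N K).map (MulAut.conj g₁).toMonoidHom).subgroupOf (unitaryGroupOfForm σ H))) = u') ↔
      mapGL (u : GL (Fin N) K) (stdLattice K N) = mapGL (u' : GL (Fin N) K) (stdLattice K N) ∧
        mapGL ((u : GL (Fin N) K) * g₁) (stdLattice K N) = mapGL ((u' : GL (Fin N) K) * g₁) (stdLattice K N) := by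
  rw [QuotientGroup.eq, Subgroup.mem_inf, ← QuotientGroup.eq, ← QuotientGroup.eq, mk_eq_mk_iff_mapGL_stdLattice_eq, mk_eq_mk_conj_iff_mapGL_stdLattice_eq]

omit [ValuativeRel K] [(Valued.v : Valuation K ℤᵐ⁰).Compatible] in
/-- `α_γ v = v` iff `γ` fixes the lattice `v`. [cite: BruhatTits1972, §10] -/
theorem latticeGraphIso_apply_eq_self_iff (γ : ↥(unitaryGroupOfForm σ H)) (v : {M : Submodule (Valued.integer K) (Fin N → K) // IsVertex σ ϖ H M}) :
    latticeGraphIso σ ϖ H γ v = v ↔ mapGL (γ : GL (Fin N) K) v.1 = v.1 := by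
  rw [← Subtype.coe_inj, latticeGraphIso_apply_coe]
  rfl

end Dictionary

/-! ## §2 The three equivalences (A), (B), (I) with fixed lattices (any rank, transitivity as binders) -/

section Equivalences

variable (σ : K →+* K) (ϖ : K) (H : Matrix (Fin N) (Fin N) K)

/-- **(A) `Fix_γ(U ⧸ K₀)` ≃ the `γ`-fixed self-dual vertices, WITH VALUES** (when the root `L₀` is self-dual and `U` is transitive on self-dual lattices): an equivalence `e`
with `e (u K₀) = u·L₀` — so that `e` intertwines the left translation by any `τ ∈ Z_U(γ)` with `τ·` on vertices. [cite: Kottwitz1988, §2] [cite: Kottwitz1986, §3] -/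
theorem exists_fixedBy_equiv_fixed_selfDual_rankN (hL₀ : IsSelfDualLattice σ ϖ H (stdLattice K N))
    (hA : ∀ M : Submodule (Valued.integer K) (Fin N → K), IsSelfDualLattice σ ϖ H M → ∃ u : ↥(unitaryGroupOfForm σ H), mapGL (u : GL (Fin N) K) (stdLattice K N) = M)
    (γ : ↥(unitaryGroupOfForm σ H)) :
    ∃ e : MulAction.fixedBy (↥(unitaryGroupOfForm σ H) ⧸ (glInt N K).subgroupOf (unitaryGroupOfForm σ H)) γ ≃
        ↥{v : {M : Submodule (Valued.integer K) (Fin N → K) // IsVertex σ ϖ H M} | latticeGraphIso σ ϖ H γ v = v ∧ IsSelfDualLattice σ ϖ H v.1},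
      ∀ (u : ↥(unitaryGroupOfForm σ H)) (hu : (u : ↥(unitaryGroupOfForm σ H) ⧸ (glInt N K).subgroupOf (unitaryGroupOfForm σ H)) ∈
        MulAction.fixedBy (↥(unitaryGroupOfForm σ H) ⧸ (glInt N K).subgroupOf (unitaryGroupOfForm σ H)) γ),
        (e ⟨_, hu⟩).1.1 = mapGL (u : GL (Fin N) K) (stdLattice K N) := by
  classical
  have hsd : ∀ u : ↥(unitaryGroupOfForm σ H), IsSelfDualLattice σ ϖ H (mapGL (u : GL (Fin N) K) (stdLattice K N)) := fun u =>
    isVertexLattice_mapGL σ ϖ H _ u.2 hL₀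
  -- the inverse dictionary `v ↦ u K₀` for any `u` with `u·L₀ = v`
  have hgmem : ∀ v : ↥{v : {M : Submodule (Valued.integer K) (Fin N → K) // IsVertex σ ϖ H M} | latticeGraphIso σ ϖ H γ v = v ∧ IsSelfDualLattice σ ϖ H v.1},
      ((Classical.choose (hA v.1.1 v.2.2) : ↥(unitaryGroupOfForm σ H)) : ↥(unitaryGroupOfForm σ H) ⧸ (glInt N K).subgroupOf (unitaryGroupOfForm σ H)) ∈
        MulAction.fixedBy (↥(unitaryGroupOfForm σ H) ⧸ (glInt N K).subgroupOf (unitaryGroupOfForm σ H)) γ := fun v => by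
    have hu := Classical.choose_spec (hA v.1.1 v.2.2)
    exact (mk_mem_fixedBy_iff_mapGL_stdLattice_eq σ H γ _).2
      (((congrArg (mapGL (γ : GL (Fin N) K)) hu).trans ((latticeGraphIso_apply_eq_self_iff σ ϖ H _ _).1 v.2.1)).trans hu.symm)
  let g : ↥{v : {M : Submodule (Valued.integer K) (Fin N → K) // IsVertex σ ϖ H M} | latticeGraphIso σ ϖ H γ v = v ∧ IsSelfDualLattice σ ϖ H v.1} →
      MulAction.fixedBy (↥(unitaryGroupOfForm σ H) ⧸ (glInt N K).subgroupOf (unitaryGroupOfForm σ H)) γ := fun v => ⟨_, hgmem v⟩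
  -- the fixed self-dual vertex `u·L₀` of a fixed coset `u K₀`
  let w : ∀ (u : ↥(unitaryGroupOfForm σ H)), (u : ↥(unitaryGroupOfForm σ H) ⧸ (glInt N K).subgroupOf (unitaryGroupOfForm σ H)) ∈
      MulAction.fixedBy (↥(unitaryGroupOfForm σ H) ⧸ (glInt N K).subgroupOf (unitaryGroupOfForm σ H)) γ →
      ↥{v : {M : Submodule (Valued.integer K) (Fin N → K) // IsVertex σ ϖ H M} | latticeGraphIso σ ϖ H γ v = v ∧ IsSelfDualLattice σ ϖ H v.1} := fun u hu =>
    ⟨⟨mapGL (u : GL (Fin N) K) (stdLattice K N), ⟨0, hsd u⟩⟩, (latticeGraphIso_apply_eq_self_iff σ ϖ H _ _).2 ((mk_mem_fixedBy_iff_mapGL_stdLattice_eq σ H γ u).1 hu), hsd u⟩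
  have hgw : ∀ u hu, g (w u hu) = ⟨_, hu⟩ := fun u hu => Subtype.ext ((mk_eq_mk_iff_mapGL_stdLattice_eq σ H _ _).2 (Classical.choose_spec (hA _ (hsd u))))
  have hg : Function.Bijective g := by
    refine ⟨fun v v' hvv' => ?_, ?_⟩
    · have h' := (mk_eq_mk_iff_mapGL_stdLattice_eq σ H _ _).1 (congrArg Subtype.val hvv')
      exact Subtype.ext (Subtype.ext (((Classical.choose_spec (hA v.1.1 v.2.2)).symm.trans h').trans (Classical.choose_spec (hA v'.1.1 v'.2.2))))
    · rintro ⟨x, hx⟩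
      induction x using QuotientGroup.induction_on with
      | H u => exact ⟨w u hx, hgw u hx⟩
  refine ⟨(Equiv.ofBijective g hg).symm, fun u hu => ?_⟩
  rw [(Equiv.symm_apply_eq _).2 (hgw u hu).symm]

/-- **(B) `Fix_γ(U ⧸ K₁)` ≃ the `γ`-fixed vertices of type `d`, WITH VALUES** (when `g₁·L₀` has type `d` and `U` is transitive on type-`d` lattices; `K₁ = Stab_U(g₁·L₀)`):
an equivalence `e` with `e (u K₁) = (u g₁)·L₀`. [cite: Kottwitz1988, §2] [cite: Kottwitz1986, §3] -/
theorem exists_fixedBy_conj_equiv_fixed_type {d : ℕ} {g₁ : GL (Fin N) K} (hg₁ : IsVertexLattice σ ϖ H d (mapGL g₁ (stdLattice K N)))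
    (hB : ∀ M : Submodule (Valued.integer K) (Fin N → K), IsVertexLattice σ ϖ H d M → ∃ u : ↥(unitaryGroupOfForm σ H), mapGL ((u : GL (Fin N) K) * g₁) (stdLattice K N) = M)
    (γ : ↥(unitaryGroupOfForm σ H)) :
    ∃ e : MulAction.fixedBy (↥(unitaryGroupOfForm σ H) ⧸ ((glInt N K).map (MulAut.conj g₁).toMonoidHom).subgroupOf (unitaryGroupOfForm σ H)) γ ≃
        ↥{v : {M : Submodule (Valued.integer K) (Fin N → K) // IsVertex σ ϖ H M} | latticeGraphIso σ ϖ H γ v = v ∧ IsVertexLattice σ ϖ H d v.1},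
      ∀ (u : ↥(unitaryGroupOfForm σ H)) (hu : (u : ↥(unitaryGroupOfForm σ H) ⧸ ((glInt N K).map (MulAut.conj g₁).toMonoidHom).subgroupOf (unitaryGroupOfForm σ H)) ∈
        MulAction.fixedBy (↥(unitaryGroupOfForm σ H) ⧸ ((glInt N K).map (MulAut.conj g₁).toMonoidHom).subgroupOf (unitaryGroupOfForm σ H)) γ),
        (e ⟨_, hu⟩).1.1 = mapGL ((u : GL (Fin N) K) * g₁) (stdLattice K N) := by
  classical
  have htd : ∀ u : ↥(unitaryGroupOfForm σ H), IsVertexLattice σ ϖ H d (mapGL ((u : GL (Fin N) K) * g₁) (stdLattice K N)) := fun u => by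
    rw [mapGL_mul]; exact isVertexLattice_mapGL σ ϖ H _ u.2 hg₁
  have hgmem : ∀ v : ↥{v : {M : Submodule (Valued.integer K) (Fin N → K) // IsVertex σ ϖ H M} | latticeGraphIso σ ϖ H γ v = v ∧ IsVertexLattice σ ϖ H d v.1},
      ((Classical.choose (hB v.1.1 v.2.2) : ↥(unitaryGroupOfForm σ H)) : ↥(unitaryGroupOfForm σ H) ⧸ ((glInt N K).map (MulAut.conj g₁).toMonoidHom).subgroupOf (unitaryGroupOfForm σ H)) ∈
        MulAction.fixedBy (↥(unitaryGroupOfForm σ H) ⧸ ((glInt N K).map (MulAut.conj g₁).toMonoidHom).subgroupOf (unitaryGroupOfForm σ H)) γ := fun v => by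
    have hu := Classical.choose_spec (hB v.1.1 v.2.2)
    exact (mk_mem_fixedBy_conj_iff_mapGL_stdLattice_eq σ H g₁ γ _).2
      (((congrArg (mapGL (γ : GL (Fin N) K)) hu).trans ((latticeGraphIso_apply_eq_self_iff σ ϖ H _ _).1 v.2.1)).trans hu.symm)
  let g : ↥{v : {M : Submodule (Valued.integer K) (Fin N → K) // IsVertex σ ϖ H M} | latticeGraphIso σ ϖ H γ v = v ∧ IsVertexLattice σ ϖ H d v.1} →
      MulAction.fixedBy (↥(unitaryGroupOfForm σ H) ⧸ ((glInt N K).map (MulAut.conj g₁).toMonoidHom).subgroupOf (unitaryGroupOfForm σ H)) γ := fun v => ⟨_, hgmem v⟩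
  let w : ∀ (u : ↥(unitaryGroupOfForm σ H)), (u : ↥(unitaryGroupOfForm σ H) ⧸ ((glInt N K).map (MulAut.conj g₁).toMonoidHom).subgroupOf (unitaryGroupOfForm σ H)) ∈
      MulAction.fixedBy (↥(unitaryGroupOfForm σ H) ⧸ ((glInt N K).map (MulAut.conj g₁).toMonoidHom).subgroupOf (unitaryGroupOfForm σ H)) γ →
      ↥{v : {M : Submodule (Valued.integer K) (Fin N → K) // IsVertex σ ϖ H M} | latticeGraphIso σ ϖ H γ v = v ∧ IsVertexLattice σ ϖ H d v.1} := fun u hu =>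
    ⟨⟨mapGL ((u : GL (Fin N) K) * g₁) (stdLattice K N), ⟨d, htd u⟩⟩,
      (latticeGraphIso_apply_eq_self_iff σ ϖ H _ _).2 ((mk_mem_fixedBy_conj_iff_mapGL_stdLattice_eq σ H g₁ γ u).1 hu), htd u⟩
  have hgw : ∀ u hu, g (w u hu) = ⟨_, hu⟩ := fun u hu => Subtype.ext ((mk_eq_mk_conj_iff_mapGL_stdLattice_eq σ H g₁ _ _).2 (Classical.choose_spec (hB _ (htd u))))
  have hg : Function.Bijective g := by
    refine ⟨fun v v' hvv' => ?_, ?_⟩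
    · have h' := (mk_eq_mk_conj_iff_mapGL_stdLattice_eq σ H g₁ _ _).1 (congrArg Subtype.val hvv')
      exact Subtype.ext (Subtype.ext (((Classical.choose_spec (hB v.1.1 v.2.2)).symm.trans h').trans (Classical.choose_spec (hB v'.1.1 v'.2.2))))
    · rintro ⟨x, hx⟩
      induction x using QuotientGroup.induction_on with
      | H u => exact ⟨w u hx, hgw u hx⟩
  refine ⟨(Equiv.ofBijective g hg).symm, fun u hu => ?_⟩
  rw [(Equiv.symm_apply_eq _).2 (hgw u hu).symm]

/-- Every `γ`-fixed coset `u (K₀ ⊓ K₁)` comes from the `γ`-fixed flag `((u g₁)·L₀ < u·L₀)` (when `L₀` is self-dual, `g₁·L₀` has type `d` and `g₁·L₀ < L₀`).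
[cite: Kottwitz1988, §2] [cite: Serre1980Trees, II.1.1] -/
theorem exists_fixed_flag_of_mem_fixedBy_inf_rankN (hL₀ : IsSelfDualLattice σ ϖ H (stdLattice K N)) {d : ℕ} {g₁ : GL (Fin N) K}
    (hg₁ : IsVertexLattice σ ϖ H d (mapGL g₁ (stdLattice K N))) (hlt₁ : mapGL g₁ (stdLattice K N) < stdLattice K N)
    (γ : ↥(unitaryGroupOfForm σ H))
    (x : ↥(unitaryGroupOfForm σ H) ⧸ ((glInt N K).subgroupOf (unitaryGroupOfForm σ H) ⊓ ((glInt N K).map (MulAut.conj g₁).toMonoidHom).subgroupOf (unitaryGroupOfForm σ H)))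
    (hx : x ∈ MulAction.fixedBy (↥(unitaryGroupOfForm σ H) ⧸ ((glInt N K).subgroupOf (unitaryGroupOfForm σ H) ⊓
      ((glInt N K).map (MulAut.conj g₁).toMonoidHom).subgroupOf (unitaryGroupOfForm σ H))) γ) :
    ∃ p : {p : {M : Submodule (Valued.integer K) (Fin N → K) // IsVertex σ ϖ H M} × {M : Submodule (Valued.integer K) (Fin N → K) // IsVertex σ ϖ H M} //
        IsSelfDualLattice σ ϖ H p.1.1 ∧ IsVertexLattice σ ϖ H d p.2.1 ∧ p.2.1 < p.1.1 ∧ latticeGraphIso σ ϖ H γ p.1 = p.1 ∧ latticeGraphIso σ ϖ H γ p.2 = p.2},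
      ∀ u' : ↥(unitaryGroupOfForm σ H), mapGL (u' : GL (Fin N) K) (stdLattice K N) = p.1.1.1 → mapGL ((u' : GL (Fin N) K) * g₁) (stdLattice K N) = p.1.2.1 →
        (u' : ↥(unitaryGroupOfForm σ H) ⧸ ((glInt N K).subgroupOf (unitaryGroupOfForm σ H) ⊓ ((glInt N K).map (MulAut.conj g₁).toMonoidHom).subgroupOf (unitaryGroupOfForm σ H))) = x := by
  induction x using QuotientGroup.induction_on with
  | H u =>
    have hx' := (mk_mem_fixedBy_inf_iff_rankN σ H g₁ γ u).1 hx
    have h1 : IsSelfDualLattice σ ϖ H (mapGL (u : GL (Fin N) K) (stdLattice K N)) := isVertexLattice_mapGL σ ϖ H _ u.2 hL₀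
    have h2 : IsVertexLattice σ ϖ H d (mapGL ((u : GL (Fin N) K) * g₁) (stdLattice K N)) := by
      rw [mapGL_mul]; exact isVertexLattice_mapGL σ ϖ H _ u.2 hg₁
    have h3 : mapGL ((u : GL (Fin N) K) * g₁) (stdLattice K N) < mapGL (u : GL (Fin N) K) (stdLattice K N) := by
      rw [mapGL_mul]; exact (mapGL_lt_mapGL_iff _ _ _).2 hlt₁
    refine ⟨⟨(⟨mapGL (u : GL (Fin N) K) (stdLattice K N), ⟨0, h1⟩⟩, ⟨mapGL ((u : GL (Fin N) K) * g₁) (stdLattice K N), ⟨d, h2⟩⟩),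
      h1, h2, h3, (latticeGraphIso_apply_eq_self_iff σ ϖ H _ _).2 hx'.1, (latticeGraphIso_apply_eq_self_iff σ ϖ H _ _).2 hx'.2⟩, fun u' hu1 hu2 => ?_⟩
    exact (mk_eq_mk_inf_iff_rankN σ H g₁ _ _).2 ⟨hu1, hu2⟩

/-- **(I, cosets → flags)** `Fix_γ(U ⧸ (K₀ ⊓ K₁))` ≃ the `γ`-fixed flags `(L self-dual, M of type d, M < L)`, WITH VALUES (when `U` is transitive on such flags, the base
flag being `g₁·L₀ < L₀`): an equivalence `e` with `e (u (K₀ ⊓ K₁)) = (u·L₀, (u g₁)·L₀)`. [cite: Kottwitz1988, §2] [cite: Serre1980Trees, II.1.1] -/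
theorem exists_fixedBy_inf_equiv_fixed_flags_rankN (hL₀ : IsSelfDualLattice σ ϖ H (stdLattice K N)) {d : ℕ} {g₁ : GL (Fin N) K}
    (hg₁ : IsVertexLattice σ ϖ H d (mapGL g₁ (stdLattice K N))) (hlt₁ : mapGL g₁ (stdLattice K N) < stdLattice K N)
    (hI : ∀ L M : Submodule (Valued.integer K) (Fin N → K), IsSelfDualLattice σ ϖ H L → IsVertexLattice σ ϖ H d M → M < L →
      ∃ u : ↥(unitaryGroupOfForm σ H), mapGL (u : GL (Fin N) K) (stdLattice K N) = L ∧ mapGL ((u : GL (Fin N) K) * g₁) (stdLattice K N) = M)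
    (γ : ↥(unitaryGroupOfForm σ H)) :
    ∃ e : MulAction.fixedBy (↥(unitaryGroupOfForm σ H) ⧸ ((glInt N K).subgroupOf (unitaryGroupOfForm σ H) ⊓
        ((glInt N K).map (MulAut.conj g₁).toMonoidHom).subgroupOf (unitaryGroupOfForm σ H))) γ ≃
      {p : {M : Submodule (Valued.integer K) (Fin N → K) // IsVertex σ ϖ H M} × {M : Submodule (Valued.integer K) (Fin N → K) // IsVertex σ ϖ H M} //
        IsSelfDualLattice σ ϖ H p.1.1 ∧ IsVertexLattice σ ϖ H d p.2.1 ∧ p.2.1 < p.1.1 ∧ latticeGraphIso σ ϖ H γ p.1 = p.1 ∧ latticeGraphIso σ ϖ H γ p.2 = p.2},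
      ∀ (u : ↥(unitaryGroupOfForm σ H)) (hu : (u : ↥(unitaryGroupOfForm σ H) ⧸ ((glInt N K).subgroupOf (unitaryGroupOfForm σ H) ⊓
        ((glInt N K).map (MulAut.conj g₁).toMonoidHom).subgroupOf (unitaryGroupOfForm σ H))) ∈
          MulAction.fixedBy (↥(unitaryGroupOfForm σ H) ⧸ ((glInt N K).subgroupOf (unitaryGroupOfForm σ H) ⊓
            ((glInt N K).map (MulAut.conj g₁).toMonoidHom).subgroupOf (unitaryGroupOfForm σ H))) γ),
        (e ⟨_, hu⟩).1.1.1 = mapGL (u : GL (Fin N) K) (stdLattice K N) ∧ (e ⟨_, hu⟩).1.2.1 = mapGL ((u : GL (Fin N) K) * g₁) (stdLattice K N) := by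
  classical
  -- a transversal `φ` of the fixed flags (choice applied to `hI`)
  obtain ⟨φ, hφ⟩ : ∃ φ : {p : {M : Submodule (Valued.integer K) (Fin N → K) // IsVertex σ ϖ H M} × {M : Submodule (Valued.integer K) (Fin N → K) // IsVertex σ ϖ H M} //
      IsSelfDualLattice σ ϖ H p.1.1 ∧ IsVertexLattice σ ϖ H d p.2.1 ∧ p.2.1 < p.1.1 ∧ latticeGraphIso σ ϖ H γ p.1 = p.1 ∧ latticeGraphIso σ ϖ H γ p.2 = p.2} →
        ↥(unitaryGroupOfForm σ H), ∀ p, mapGL (φ p : GL (Fin N) K) (stdLattice K N) = p.1.1.1 ∧ mapGL ((φ p : GL (Fin N) K) * g₁) (stdLattice K N) = p.1.2.1 :=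
    ⟨fun p => Classical.choose (hI p.1.1.1 p.1.2.1 p.2.1 p.2.2.1 p.2.2.2.1), fun p => Classical.choose_spec (hI p.1.1.1 p.1.2.1 p.2.1 p.2.2.1 p.2.2.2.1)⟩
  have hmem : ∀ p : {p : {M : Submodule (Valued.integer K) (Fin N → K) // IsVertex σ ϖ H M} × {M : Submodule (Valued.integer K) (Fin N → K) // IsVertex σ ϖ H M} //
      IsSelfDualLattice σ ϖ H p.1.1 ∧ IsVertexLattice σ ϖ H d p.2.1 ∧ p.2.1 < p.1.1 ∧ latticeGraphIso σ ϖ H γ p.1 = p.1 ∧ latticeGraphIso σ ϖ H γ p.2 = p.2},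
      ((φ p : ↥(unitaryGroupOfForm σ H)) : ↥(unitaryGroupOfForm σ H) ⧸ ((glInt N K).subgroupOf (unitaryGroupOfForm σ H) ⊓
        ((glInt N K).map (MulAut.conj g₁).toMonoidHom).subgroupOf (unitaryGroupOfForm σ H))) ∈
        MulAction.fixedBy (↥(unitaryGroupOfForm σ H) ⧸ ((glInt N K).subgroupOf (unitaryGroupOfForm σ H) ⊓
          ((glInt N K).map (MulAut.conj g₁).toMonoidHom).subgroupOf (unitaryGroupOfForm σ H))) γ := fun p =>
    (mk_mem_fixedBy_inf_iff_rankN σ H g₁ γ _).2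
      ⟨((congrArg (mapGL (γ : GL (Fin N) K)) (hφ p).1).trans ((latticeGraphIso_apply_eq_self_iff σ ϖ H _ _).1 p.2.2.2.2.1)).trans (hφ p).1.symm,
        ((congrArg (mapGL (γ : GL (Fin N) K)) (hφ p).2).trans ((latticeGraphIso_apply_eq_self_iff σ ϖ H _ _).1 p.2.2.2.2.2)).trans (hφ p).2.symm⟩
  let g : {p : {M : Submodule (Valued.integer K) (Fin N → K) // IsVertex σ ϖ H M} × {M : Submodule (Valued.integer K) (Fin N → K) // IsVertex σ ϖ H M} //
      IsSelfDualLattice σ ϖ H p.1.1 ∧ IsVertexLattice σ ϖ H d p.2.1 ∧ p.2.1 < p.1.1 ∧ latticeGraphIso σ ϖ H γ p.1 = p.1 ∧ latticeGraphIso σ ϖ H γ p.2 = p.2} →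
      MulAction.fixedBy (↥(unitaryGroupOfForm σ H) ⧸ ((glInt N K).subgroupOf (unitaryGroupOfForm σ H) ⊓
        ((glInt N K).map (MulAut.conj g₁).toMonoidHom).subgroupOf (unitaryGroupOfForm σ H))) γ := fun p => ⟨_, hmem p⟩
  have hg : Function.Bijective g := by
    refine ⟨fun p q hpq => ?_, ?_⟩
    · have h' := (mk_eq_mk_inf_iff_rankN σ H g₁ _ _).1 (congrArg Subtype.val hpq)
      exact Subtype.ext (Prod.ext (Subtype.ext (((hφ p).1.symm.trans h'.1).trans (hφ q).1)) (Subtype.ext (((hφ p).2.symm.trans h'.2).trans (hφ q).2)))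
    · rintro ⟨x, hx⟩
      obtain ⟨p, hp⟩ := exists_fixed_flag_of_mem_fixedBy_inf_rankN σ ϖ H hL₀ hg₁ hlt₁ γ x hx
      exact ⟨p, Subtype.ext (hp _ (hφ p).1 (hφ p).2)⟩
  refine ⟨(Equiv.ofBijective g hg).symm, fun u hu => ?_⟩
  -- the value at `u (K₀ ⊓ K₁)`: the flag `(u·L₀, (u g₁)·L₀)`
  obtain ⟨p, hp⟩ := exists_fixed_flag_of_mem_fixedBy_inf_rankN σ ϖ H hL₀ hg₁ hlt₁ γ _ hu
  -- `p` is the flag of `u` itself: compare through the transversal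
  have hgp : g p = ⟨_, hu⟩ := Subtype.ext (hp _ (hφ p).1 (hφ p).2)
  have hval : (Equiv.ofBijective g hg).symm ⟨_, hu⟩ = p := (Equiv.symm_apply_eq _).2 hgp.symm
  have hpu := (mk_eq_mk_inf_iff_rankN σ H g₁ _ _).1 (congrArg Subtype.val hgp)
  rw [hval]
  exact ⟨((hφ p).1.symm.trans hpu.1), ((hφ p).2.symm.trans hpu.2)⟩

end Equivalences

end Literature.NumberTheory.Automorphic.UnitaryLatticeTree

end
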